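import Mathlib

/-!
# Finiteness of the regular preimages in a compact set (Kronecker existence theorem, step K3)

Crux `WitnessCharge` (stmt-SmoothPoincare4-7824), route `SullivanDual`, line Sketch. The F5
programme (McDuff's cusp theorem via the twisted difference map of a `J`-holomorphic curve) uses a
Kronecker existence theorem on sup-norm cubes of `ℝⁿ⁺¹` (`Fin (n + 1) → ℝ`), whose torus index
theorem takes a *finset* of zeros. This file supplies the finiteness: if `f : ℝⁿ⁺¹ → ℝⁿ⁺¹` is
`C¹`, `K` is compact and `det Df(x) ≠ 0` at every `x ∈ K` with `f x = c`, then
`{x ∈ K | f x = c}` is finite.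

Proof: `Z := {x ∈ K | f x = c}` is compact (closed condition inside a compact set). At every
`x ∈ Z` the inverse function theorem (`HasStrictFDerivAt.toOpenPartialHomeomorph`, after turning
`Df(x)` into a continuous linear equivalence with
`ContinuousLinearMap.toContinuousLinearEquivOfDetNeZero`) makes `f` injective on a neighbourhood
of `x`, so `Z` is discrete (`IsDiscrete.of_openPartialHomeomorph`); a compact discrete set is
finite (`IsCompact.finite`).

Mathlib only; no definitions, no `sorry`.
-/

noncomputable section

-- the summit path `SmoothPoincare4/SmoothPoincare4` forces a duplicated namespace segment
set_option linter.dupNamespace false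

open Set Filter Metric Function
open scoped Topology

namespace Summit.SmoothPoincare4.SmoothPoincare4.Theorems.WitnessCharge.PencilIncompleteness

/-- **K3 — finiteness of the regular preimages in a compact set.** Let `f : ℝⁿ⁺¹ → ℝⁿ⁺¹` be
`C¹`, `K` compact, and assume `det Df(x) ≠ 0` at every `x ∈ K` with `f x = c`. Then the set
`{x ∈ K | f x = c}` is finite: it is compact, and discrete by the inverse function theorem. -/
theorem helper_kronecker_finiteZeros :
    ∀ (n : ℕ) (f : (Fin (n + 1) → ℝ) → (Fin (n + 1) → ℝ)) (K : Set (Fin (n + 1) → ℝ))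
      (c : Fin (n + 1) → ℝ),
      ContDiff ℝ 1 f → IsCompact K → (∀ x ∈ K, f x = c → (fderiv ℝ f x).det ≠ 0) →
      {x ∈ K | f x = c}.Finite := by
  intro n f K c hf hK hdet
  -- the zero set is compact: a closed condition inside the compact set `K`
  have hZc : IsCompact {x ∈ K | f x = c} :=
    hK.inter_right (isClosed_eq hf.continuous continuous_const)
  -- the zero set is discrete: `f` is a local homeomorphism near each of its points
  have hZd : IsDiscrete {x ∈ K | f x = c} := by
    refine IsDiscrete.of_openPartialHomeomorph f (fun x hx => hx.2) fun x hx => ?_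
    -- the derivative at `x` as a continuous linear equivalence, and the strict derivative
    obtain ⟨A, hAe⟩ : ∃ A : (Fin (n + 1) → ℝ) ≃L[ℝ] (Fin (n + 1) → ℝ),
        (A : (Fin (n + 1) → ℝ) →L[ℝ] (Fin (n + 1) → ℝ)) = fderiv ℝ f x :=
      ⟨_, (fderiv ℝ f x).coe_toContinuousLinearEquivOfDetNeZero (hdet x hx.1 hx.2)⟩
    have hsd : HasStrictFDerivAt f (A : (Fin (n + 1) → ℝ) →L[ℝ] (Fin (n + 1) → ℝ)) x := by
      rw [hAe]
      exact hf.contDiffAt.hasStrictFDerivAt one_ne_zero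
    exact ⟨hsd.toOpenPartialHomeomorph f, hsd.mem_toOpenPartialHomeomorph_source,
      hsd.toOpenPartialHomeomorph_coe⟩
  exact hZc.finite hZd

end Summit.SmoothPoincare4.SmoothPoincare4.Theorems.WitnessCharge.PencilIncompleteness
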